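import Mathlib
import Summits.NavierStokesRegularity.NavierStokesRegularity.Theses.QuantisedSymmetry
import Literature.Analysis.FluidPDE.NSBoundedMildOseen
import Literature.Analysis.FluidPDE.MildSolution
import Literature.Analysis.FluidPDE.VectorCalculus

/-!
# Strategist s22-g4 — typed split B1 (computer-assisted Newton–Kantorovich for the cell map)

NOT FILED (see STRATEGY-CENSUS-s22.md, `## Decomposition`): the hard piece `CertifiedApproximateCell`
is the crux made quantitative (a nondegenerate relative periodic orbit with a certified enclosure) and
no numerical candidate exists anywhere. Recorded here only so the census's "best typed split" is a set of
elaborating signatures, not prose.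
-/

open MeasureTheory Literature.Analysis.FluidPDE
open scoped ENNReal

noncomputable section

namespace Summit.NavierStokesRegularity.NavierStokesRegularity.Cruxes.PolyhedralDssProfileExists.StrategistS22

/-- ℝ³. -/
abbrev E3 := EuclideanSpace ℝ (Fin 3)

/-- `1 ≤ 4` in `ℝ≥0∞` (Mathlib registers the `Fact` only for `1, 2, ⊤`); sketch-local. -/
instance factOneLeFour : Fact ((1 : ℝ≥0∞) ≤ 4) := ⟨by norm_num⟩
/-- The phase space of the cell map: `L⁴(ℝ³; ℝ³)` (subcritical, Kato class). -/
abbrev L4 := Lp E3 4 (volume : Measure E3)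

/-- `R` is the `c`-rescaled Navier–Stokes period map ("cell map") on the `L⁴`-ball `B(w₀, r)`:
for every `w` in the ball there is a weakly-div-free mild solution `v` on `[-1, -c⁻²]`, continuous and
bounded on every `[-1+δ, -c⁻²] × ℝ³`, continuous up to `t = -1` when `w` has a bounded continuous
representative, with `v(-1) = w` a.e., `G`-equivariant when `w` is, and `R w = c⁻¹ • v(-c⁻²)(c⁻¹ • ·)`
a.e. (Kato 1984 local theory in `L^p`, `p > 3`; isometry covariance of mild solutions). -/
def IsCellMapOn (G : Subgroup (E3 ≃ₗᵢ[ℝ] E3)) (c : ℝ) (w₀ : L4) (r : ℝ) (R : L4 → L4) : Prop :=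
  ∀ w ∈ Metric.closedBall w₀ r, ∃ v : ℝ → E3 → E3,
    (∀ δ : ℝ, 0 < δ → ContinuousOn (Function.uncurry v) (Set.Icc (-1 + δ) (-(c ^ 2)⁻¹) ×ˢ Set.univ) ∧
      ∃ M : ℝ, ∀ t ∈ Set.Icc (-1 + δ) (-(c ^ 2)⁻¹), ∀ x, ‖v t x‖ ≤ M) ∧
    ((∃ w' : E3 → E3, Continuous w' ∧ (∃ M : ℝ, ∀ x, ‖w' x‖ ≤ M) ∧ w' =ᵐ[volume] (w : E3 → E3)) →
      ContinuousOn (Function.uncurry v) (Set.Icc (-1 : ℝ) (-(c ^ 2)⁻¹) ×ˢ Set.univ) ∧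
      Continuous (v (-1)) ∧ ∃ M : ℝ, ∀ t ∈ Set.Icc (-1 : ℝ) (-(c ^ 2)⁻¹), ∀ x, ‖v t x‖ ≤ M) ∧
    (∀ t ∈ Set.Icc (-1 : ℝ) (-(c ^ 2)⁻¹), IsWeaklyDivFree (v t)) ∧
    (∀ s t : ℝ, -1 ≤ s → s < t → t ≤ -(c ^ 2)⁻¹ → ∀ x,
        v t x = heatFlow (v s) (t - s) x - oseenDuhamel 1 s v v t x) ∧
    (v (-1) =ᵐ[volume] (w : E3 → E3)) ∧
    ((∀ g ∈ G, (fun x => (w : E3 → E3) (g x)) =ᵐ[volume] fun x => g ((w : E3 → E3) x)) →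
      ∀ g ∈ G, ∀ t ∈ Set.Icc (-1 : ℝ) (-(c ^ 2)⁻¹), ∀ x, v t (g x) = g (v t x)) ∧
    ((R w : E3 → E3) =ᵐ[volume] fun x => c⁻¹ • v (-(c ^ 2)⁻¹) (c⁻¹ • x))

/-- **D2 (support, M; provable): Newton–Kantorovich.** A `C¹` map between Banach spaces with small
residual at `x₀`, invertible derivative at `x₀` with inverse bound `K`, and `L`-Lipschitz derivative on a
ball has a zero within `2Kε` of `x₀` when `K·L·(Kε) ≤ 1/2` (Kantorovich 1948; Ortega–Rheinboldt Thm 12.6.2). -/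
def NewtonKantorovich : Prop :=
  ∀ (X Y : Type) [NormedAddCommGroup X] [NormedSpace ℝ X] [CompleteSpace X]
    [NormedAddCommGroup Y] [NormedSpace ℝ Y] [CompleteSpace Y]
    (F : X → Y) (x₀ : X) (A : X ≃L[ℝ] Y) (ε K L r : ℝ),
    0 ≤ ε → 0 < K → 0 ≤ L → 0 < r →
    ‖F x₀‖ ≤ ε →
    (∀ x ∈ Metric.closedBall x₀ r, HasFDerivAt F (fderiv ℝ F x) x) →
    (A : X →L[ℝ] Y) = fderiv ℝ F x₀ →
    ‖(A.symm : Y →L[ℝ] X)‖ ≤ K →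
    (∀ x ∈ Metric.closedBall x₀ r, ∀ x' ∈ Metric.closedBall x₀ r,
        ‖fderiv ℝ F x - fderiv ℝ F x'‖ ≤ L * ‖x - x'‖) →
    K * L * (K * ε) ≤ 1 / 2 → 2 * K * ε ≤ r →
    ∃ x ∈ Metric.closedBall x₀ (2 * K * ε), F x = 0

/-- **D1 (the hard piece = the crux made quantitative; NO candidate known): a certified approximate
polyhedral cell.** A finite irreducible rotation group `G`, the closed subspace `Y ⊆ L⁴` of `G`-equivariant
classes, an approximate relative periodic orbit `x₀ = (w₀, c₀)` of the BORDERED cell residual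
`F(w, c) = (R_c w − w, ℓ(w − w₀))` (phase condition `ℓ` killing the neutral scaling mode `u ↦ u_μ`, the
factor `c` as the freed parameter), with certified residual `ε`, certified inverse bound `K` of `DF(x₀)`,
Lipschitz bound `L`, the Kantorovich inequality, and `‖w₀‖ > 2Kε` (so the exact zero is nontrivial). -/
def CertifiedApproximateCell : Prop :=
  ∃ G : Subgroup (E3 ≃ₗᵢ[ℝ] E3), Finite G ∧
    (∀ g ∈ G, LinearMap.det (g.toLinearEquiv : E3 →ₗ[ℝ] E3) = 1) ∧
    (∀ V : Submodule ℝ E3, (∀ g ∈ G, ∀ v ∈ V, g v ∈ V) → V = ⊥ ∨ V = ⊤) ∧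
  ∃ Y : Submodule ℝ L4, IsClosed (Y : Set L4) ∧
    (∀ w ∈ Y, ∀ g ∈ G, (fun x => (w : E3 → E3) (g x)) =ᵐ[volume] fun x => g ((w : E3 → E3) x)) ∧
  ∃ (R : ℝ → L4 → L4) (ℓ : L4 →L[ℝ] ℝ) (F : ↥Y × ℝ → ↥Y × ℝ) (x₀ : ↥Y × ℝ)
    (A : (↥Y × ℝ) ≃L[ℝ] (↥Y × ℝ)) (r ε K L : ℝ),
    0 ≤ ε ∧ 0 < K ∧ 0 ≤ L ∧ 0 < r ∧ 1 < x₀.2 - r ∧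
    (∀ c ∈ Metric.closedBall x₀.2 r, IsCellMapOn G c (x₀.1 : L4) r (R c) ∧ ∀ w ∈ Y, R c w ∈ Y) ∧
    (∀ x ∈ Metric.closedBall x₀ r,
        ((F x).1 : L4) = R x.2 (x.1 : L4) - (x.1 : L4) ∧ (F x).2 = ℓ ((x.1 : L4) - (x₀.1 : L4))) ∧
    ‖F x₀‖ ≤ ε ∧
    (∀ x ∈ Metric.closedBall x₀ r, HasFDerivAt F (fderiv ℝ F x) x) ∧
    (A : (↥Y × ℝ) →L[ℝ] (↥Y × ℝ)) = fderiv ℝ F x₀ ∧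
    ‖(A.symm : (↥Y × ℝ) →L[ℝ] (↥Y × ℝ))‖ ≤ K ∧
    (∀ x ∈ Metric.closedBall x₀ r, ∀ x' ∈ Metric.closedBall x₀ r,
        ‖fderiv ℝ F x - fderiv ℝ F x'‖ ≤ L * ‖x - x'‖) ∧
    K * L * (K * ε) ≤ 1 / 2 ∧ 2 * K * ε ≤ r ∧ 2 * K * ε < ‖(x₀.1 : L4)‖

/-- **D3 (support/glue, S–M; provable): a nontrivial `G`-equivariant fixed point of a cell map is a
polyhedral cell** in the exact shape of the registered stub `stub_polyhedralCellExists` (continuity up to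
`t = -1` from the bounded continuous representative `R w`; `L⁴`-membership and non-triviality of `v(-1)`
from `v(-1) = w` a.e.). -/
def CellOfFixedPoint : Prop :=
  ∀ (G : Subgroup (E3 ≃ₗᵢ[ℝ] E3)), Finite G →
    (∀ g ∈ G, LinearMap.det (g.toLinearEquiv : E3 →ₗ[ℝ] E3) = 1) →
    (∀ V : Submodule ℝ E3, (∀ g ∈ G, ∀ v ∈ V, g v ∈ V) → V = ⊥ ∨ V = ⊤) →
  ∀ (c : ℝ) (w₀ : L4) (r : ℝ) (R : L4 → L4) (w : L4), 1 < c → IsCellMapOn G c w₀ r R →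
    w ∈ Metric.closedBall w₀ r → R w = w → w ≠ 0 →
    (∀ g ∈ G, (fun x => (w : E3 → E3) (g x)) =ᵐ[volume] fun x => g ((w : E3 → E3) x)) →
  ∃ G : Subgroup (E3 ≃ₗᵢ[ℝ] E3), Finite G ∧
    (∀ g ∈ G, LinearMap.det (g.toLinearEquiv : E3 →ₗ[ℝ] E3) = 1) ∧
    (∀ V : Submodule ℝ E3, (∀ g ∈ G, ∀ v ∈ V, g v ∈ V) → V = ⊥ ∨ V = ⊤) ∧
    ∃ c : ℝ, 1 < c ∧ ∃ v : ℝ → E3 → E3,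
      (ContinuousOn (Function.uncurry v) (Set.Icc (-1 : ℝ) (-(c ^ 2)⁻¹) ×ˢ Set.univ) ∧
        (∃ M : ℝ, ∀ t ∈ Set.Icc (-1 : ℝ) (-(c ^ 2)⁻¹), ∀ x, ‖v t x‖ ≤ M) ∧
        (∀ t ∈ Set.Icc (-1 : ℝ) (-(c ^ 2)⁻¹), IsWeaklyDivFree (v t)) ∧
        (∀ s t : ℝ, -1 ≤ s → s < t → t ≤ -(c ^ 2)⁻¹ → ∀ x,
            v t x = heatFlow (v s) (t - s) x - oseenDuhamel 1 s v v t x) ∧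
        (∀ x, v (-(c ^ 2)⁻¹) x = c • v (-1) (c • x)) ∧
        (∀ g ∈ G, ∀ t ∈ Set.Icc (-1 : ℝ) (-(c ^ 2)⁻¹), ∀ x, v t (g x) = g (v t x))) ∧
      MemLp (v (-1)) 4 volume ∧ ¬ (v (-1) =ᵐ[volume] 0)

/-- The assembly of the split is modus ponens through Newton–Kantorovich: `D1 → D2 → D3 → cell`.
(Statement only; the two routine unpacking steps — the NK zero `x = (w, c)` has `R_c w = w`, `c > 1`,
`w ≠ 0`, `w ∈ Y` — are what a prover would write; not proved in this census.) -/
def SplitAssembly : Prop := CertifiedApproximateCell → NewtonKantorovich → CellOfFixedPoint →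
  ∃ G : Subgroup (E3 ≃ₗᵢ[ℝ] E3), Finite G ∧
    (∀ g ∈ G, LinearMap.det (g.toLinearEquiv : E3 →ₗ[ℝ] E3) = 1) ∧
    (∀ V : Submodule ℝ E3, (∀ g ∈ G, ∀ v ∈ V, g v ∈ V) → V = ⊥ ∨ V = ⊤) ∧
    ∃ c : ℝ, 1 < c ∧ ∃ v : ℝ → E3 → E3,
      (ContinuousOn (Function.uncurry v) (Set.Icc (-1 : ℝ) (-(c ^ 2)⁻¹) ×ˢ Set.univ) ∧
        (∃ M : ℝ, ∀ t ∈ Set.Icc (-1 : ℝ) (-(c ^ 2)⁻¹), ∀ x, ‖v t x‖ ≤ M) ∧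
        (∀ t ∈ Set.Icc (-1 : ℝ) (-(c ^ 2)⁻¹), IsWeaklyDivFree (v t)) ∧
        (∀ s t : ℝ, -1 ≤ s → s < t → t ≤ -(c ^ 2)⁻¹ → ∀ x,
            v t x = heatFlow (v s) (t - s) x - oseenDuhamel 1 s v v t x) ∧
        (∀ x, v (-(c ^ 2)⁻¹) x = c • v (-1) (c • x)) ∧
        (∀ g ∈ G, ∀ t ∈ Set.Icc (-1 : ℝ) (-(c ^ 2)⁻¹), ∀ x, v t (g x) = g (v t x))) ∧
      MemLp (v (-1)) 4 volume ∧ ¬ (v (-1) =ᵐ[volume] 0)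

end Summit.NavierStokesRegularity.NavierStokesRegularity.Cruxes.PolyhedralDssProfileExists.StrategistS22

end
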